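import Mathlib
import HarnessLib
import Literature.MathematicalPhysics.QuantumLattice.GrassmannFlowStepDB
import Literature.MathematicalPhysics.QuantumLattice.HubbardInteractionKernels
import Summits.HubbardSuperconductivity.HubbardSuperconductivity.Theorems.KLProgrammeKLRegimeEngineScaleZeroNorms
import Summits.HubbardSuperconductivity.HubbardSuperconductivity.Theorems.KLProgrammeKLRegimeEngineScaleZeroGridTransfer
import Summits.HubbardSuperconductivity.HubbardSuperconductivity.Theorems.KLProgrammeKLRegimeEngineKernelMapBound
import Summits.HubbardSuperconductivity.HubbardSuperconductivity.Theorems.KLProgrammeKLRegimeEngineValueClauseReduction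

/-!
# K3 ENGINE child (stmt-HubbardSuperconductivity-19855 `KLRegimeEngineV12`), stub `stub_engine_scale0`, the VALUES clause at scale `0`:
# the ultraviolet pair amplitude is `U + O(U²)` — `‖𝒞₀(Q; k, k′) − U‖ ≤ (96·N/β)·ρ⁻⁴·e‖Ṽ‖_h·θ/(1−θ)` from ONE determinant-bounded step

Cell gate-hubbard-kl, seat p3 (g6); items (I9)/(I10) of HOME/hubbard-kl-k3c2-p1/SCALE0-GRAM.md for the pair-amplitude ultraviolet clause
`∀ Qm, ∀ k k′ ∈ klBall, ‖klPairAmplitude … 0 Qm k k′ − U‖ ≤ initDevBar G U + legDressBarQ G P Q U 0 4` of the registered stub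
`stub_engine_scale0` ((E2-v8).1 at `n = 0`; (E2′-S2 UV) follows from it, `…EngineValueClauseReduction` / `…EngineSlotReduction`).

The chain, every link a tree theorem:
1. `klPairAmplitude … 0 Qm k k′ = 𝒱₄(𝒱^{(0)})(pairLegs Qm k k′)` and `𝒱^{(0)} = map S (effAction (SᵀC₀S) Ṽ)` on the `N = 4M` time grid
   (`EngineV8.klEffectiveAction_zero_eq_map_hubbardGridSub`, p3 g5), `Ṽ = V_N + 𝒩_{K,N}` the grid vertex, `map S Ṽ = V + 𝒩_K`
   (`map_hubbardGridSub_gridInteractionCT`);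
2. the BARE VALUE `𝒱₄(V + 𝒩_K)(pairLegs Qm k k′) = U` exactly (`HubbardInteractionKernels.vertexFn_hubbardInteractionCT_pairLegs`);
3. hence `𝒞₀ − U = 𝒱₄(map S (effAction (SᵀC₀S) Ṽ − Ṽ))(pairLegs)`, and the quartic kernel of `effAction C Ṽ − Ṽ` is SECOND order:
   pinned `ℓ¹` norm `≤ ρ⁻⁴·e‖Ṽ‖_h·θ/(1−θ)` under `IsGramBoundedR (SᵀC₀S) κ`, row/column sums `≤ α`, `θ = eα‖Ṽ‖_h/κ² < 1`
   (`GrassmannFlowStepDB.sum_norm_kernel_four_effAction_sub_le_of_gramBounded` — the top degree does not move at first order);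
4. values from pinned grid norms: `‖𝒱₄(map S F)(X′)‖ ≤ (4!/(βL²))·#(grid legs)·B`, `#(grid legs) = 4·N·L²`
   (`EngineV8.norm_vertexFn_map_hubbardGridSub_le_of_pinned`, `card_gridLeg_gridPoint`, k3c2-p1).

* `klsv_sum_norm_kernel_gridVertex_le` — the grid vertex's pinned profile with the degree-`2` size a PARAMETER `N₁` (so that either
  `sum_norm_kernel_hubbardGridCounterQuadratic_le`'s `(β/N)·coeffNorm 0 K` or the intrinsic `Σ_z‖framePosKernel‖` route can be plugged);
* **`norm_klPairAmplitude_zero_sub_le_of_gridStep`** — for EVERY `Qm, k, k′` (no ball membership is used):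
  `‖klPairAmplitude … 0 Qm k k′ − U‖ ≤ (96·N/β) · (ρ⁻⁴ · e‖Ṽ‖_h · θ/(1 − θ))`, `N = 4M`, for ANY Gram constant `κ`, decay constant `α`,
  weight `ρ`, degree-`2` size `N₁` — the SAME step data as (E1-v4)₀'s `klAnisoLegKernelNorm_zero_le_of_gridStep` (with `N₁ := (β/N)·coeffNorm 0 K`
  the two `θ`'s coincide literally); since `‖Ṽ‖_h ∝ β/N`, the bound is `M`-, `β`-, `L`-uniform and `O(U·θ) = O(U²)`;
* `norm_klPairAmplitude_zero_sub_le_of_frameOK` — the same at the tree's scale-`0` Gram constant `κ₀ = √(2(7+6047))`, `ρ = κ₀`, for every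
  admissible frame (`FrameOK R U N μ K`, `klBetaMin ≤ β ≤ L`; `isGramBoundedR_scaleZero_of_frameOK_sharp`);
* `pairAmplitudeUV_zero_of_gridStep`, `pairLadderStepAtV8_zero_of_gridStep`, `quarticValueUVAtS2_zero_of_gridStep` — the registered
  clause shapes, given the numeric comparison of the bound with `initDevBar G U + legDressBarQ G P Q U 0 4`.

What remains for this clause after this file (same list as (E1-v4)₀): the decay constant `α` (k3c4-p2's `rowSum/colSum_scaleZero_of_frameOK`),
the degree-`2` size `N₁` small (the intrinsic `κ_K` route, k3c2-p1/k3c2-p3), `θ < 1` from `U ≤ klEngU₀3`, and the comparison with the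
package tolerance (`legDressBarQ … 0 4 ≥ 4·Q.CR·(Klam U)²`, `Q.CR ≥ 2^60`).  Nothing about the model is asserted beyond these implications;
no sorry, no new definitions.
-/

noncomputable section

namespace Summit.HubbardSuperconductivity.HubbardSuperconductivity.Theorems.EngineV8

set_option linter.dupNamespace false -- summit = problem name (single-conjunct summit), D-0017

open Real Finset Literature.MathematicalPhysics.QuantumLattice Literature.Probability.LatticeModels
open Literature.MathematicalPhysics.QuantumLattice.GrassmannAlgebra
open Summit.HubbardSuperconductivity.HubbardSuperconductivity.Theorems.KLRegimeSplit
open Summit.HubbardSuperconductivity.HubbardSuperconductivity.Theorems.KLProgrammeLegKernels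

variable {L M : ℕ} [NeZero L]

/-! ## §1 The grid vertex's pinned profile with a parametric degree-`2` size -/

/-- The pinned-norm profile `N₁` (degree `2`), `|U|·|β|/N` (degree `4`), `0` otherwise is nonnegative when `N₁ ≥ 0`. -/
theorem klsv_profile_nonneg (β U : ℝ) (Ng : ℕ) {N₁ : ℝ} (hN₁ : 0 ≤ N₁) (m' : ℕ) :
    0 ≤ (if m' = 1 then N₁ else if m' = 2 then |U| * |β| / Ng else 0 : ℝ) := by
  split_ifs <;> positivity

/-- The profile vanishes above degree `4`. -/
theorem klsv_profile_of_two_lt (β U : ℝ) (Ng : ℕ) (N₁ : ℝ) {m' : ℕ} (hm' : 2 < m') :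
    (if m' = 1 then N₁ else if m' = 2 then |U| * |β| / Ng else 0 : ℝ) = 0 := by
  rw [if_neg (by omega), if_neg (by omega)]

/-- **Pinned kernel norms of the grid vertex `V_N + 𝒩_{K,N}` with a parametric degree-`2` size**: if every pinned `ℓ¹` sum of the grid
counterterm's `2`-kernel is `≤ N₁`, then `Σ_{Y : Y j = w} ‖kernel (V_N + 𝒩_{K,N}) (2m') Y‖ ≤ N(m')` with `N(1) = N₁`, `N(2) = |U|·|β|/N`,
`N(m') = 0` otherwise (p5's `sum_norm_kernel_hubbardGridInteraction_le` in degree `4`). -/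
theorem klsv_sum_norm_kernel_gridVertex_le {Ng : ℕ} (β U : ℝ) (K : TrigPolyC4v) {N₁ : ℝ} (hN₁ : 0 ≤ N₁)
    (hct : ∀ (j : Fin 2) (w : GridLeg (GridPoint L Ng)),
      ∑ Y ∈ univ.filter (fun Y : Fin 2 → GridLeg (GridPoint L Ng) => Y j = w),
        ‖kernel ℂ (hubbardGridCounterQuadratic L Ng β K) 2 Y‖ ≤ N₁)
    (m' : ℕ) (j : Fin (2 * m')) (w : GridLeg (GridPoint L Ng)) :
    ∑ Y ∈ univ.filter (fun Y : Fin (2 * m') → GridLeg (GridPoint L Ng) => Y j = w),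
        ‖kernel ℂ (hubbardGridInteraction L Ng β U + hubbardGridCounterQuadratic L Ng β K) (2 * m') Y‖ ≤
      (if m' = 1 then N₁ else if m' = 2 then |U| * |β| / Ng else 0 : ℝ) := by
  rcases m' with _ | _ | _ | m'
  · exact absurd j.2 (by omega)
  · -- degree 2: only the counterterm
    have h : ∀ Y : Fin (2 * 1) → GridLeg (GridPoint L Ng),
        kernel ℂ (hubbardGridInteraction L Ng β U + hubbardGridCounterQuadratic L Ng β K) (2 * 1) Y =
          kernel ℂ (hubbardGridCounterQuadratic L Ng β K) 2 Y := fun Y => by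
      rw [kernel_add, kernel_hubbardGridInteraction_of_ne β U (by norm_num) Y, zero_add]
    simp only [h, if_true]
    exact hct j w
  · -- degree 4: only the quartic vertex
    have h : ∀ Y : Fin (2 * 2) → GridLeg (GridPoint L Ng),
        kernel ℂ (hubbardGridInteraction L Ng β U + hubbardGridCounterQuadratic L Ng β K) (2 * 2) Y =
          kernel ℂ (hubbardGridInteraction L Ng β U) 4 Y := fun Y => by
      rw [kernel_add, kernel_hubbardGridCounterQuadratic_of_ne β K (by norm_num) Y, add_zero]
    simp only [h, show (1 + 1 : ℕ) = 2 from rfl, if_true, show (2 : ℕ) ≠ 1 by norm_num, if_false]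
    exact sum_norm_kernel_hubbardGridInteraction_le β U j w
  · -- degrees `≥ 6` vanish
    have h6 : 2 * (m' + 3) ≠ 4 := by omega
    have h6' : 2 * (m' + 3) ≠ 2 := by omega
    refine le_of_eq_of_le (sum_eq_zero fun Y _ => ?_) (klsv_profile_nonneg β U Ng hN₁ _)
    rw [kernel_add, kernel_hubbardGridInteraction_of_ne β U h6 Y, kernel_hubbardGridCounterQuadratic_of_ne β K h6' Y,
      add_zero, norm_zero]

/-- The degree-`2` size of the tree (`sum_norm_kernel_hubbardGridCounterQuadratic_le`, p3 g5): `N₁ := (|β|/N)·coeffNorm 0 K` is admissible —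
with it the profile above IS the profile of `klAnisoLegKernelNorm_zero_le_of_gridStep` ((E1-v4)₀), so the two clauses read one `θ`. -/
theorem klsv_counterQuadratic_pinned_le_coeffNorm {Ng : ℕ} (β : ℝ) (K : TrigPolyC4v) (j : Fin 2) (w : GridLeg (GridPoint L Ng)) :
    ∑ Y ∈ univ.filter (fun Y : Fin 2 → GridLeg (GridPoint L Ng) => Y j = w),
        ‖kernel ℂ (hubbardGridCounterQuadratic L Ng β K) 2 Y‖ ≤ |β| / Ng * K.coeffNorm 0 :=
  sum_norm_kernel_hubbardGridCounterQuadratic_le β K j w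

/-! ## §2 Salmhofer's vertex functions are additive (the difference form) -/

omit [NeZero L] in
/-- `𝒱_m(F − G) = 𝒱_m(F) − 𝒱_m(G)`. -/
theorem klsv_vertexFn_sub (β : ℝ) (F G : HubbardGrassmann L M) (m : ℕ) (X : Fin m → HubbardFieldIdx L M) :
    vertexFn L M β (F - G) m X = vertexFn L M β F m X - vertexFn L M β G m X := by
  have h := vertexFn_add L M β (F - G) G m X
  rw [sub_add_cancel] at h
  rw [h]
  ring

/-! ## §3 The assembly: the scale-`0` pair amplitude is `U + O(U²)` -/

/-- **The scale-`0` pair amplitude deviates from the bare value `U` at second order, from ONE determinant-bounded step** (stub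
`stub_engine_scale0`, the pair-amplitude ultraviolet clause, modulo the step data).  Let `N = 4M`, `S = hubbardGridSub L M β N`,
`C₀ = hubbardCovAboveCT … 0 K klE0`, `Ṽ = V_N + 𝒩_{K,N}`.  If `SᵀC₀S` is replica-Gram-bounded with constant `κ > 0` and has row and column sums `≤ α`,
if the grid counterterm's pinned degree-`2` norms are `≤ N₁`, and `θ = eα‖Ṽ‖_h/κ² < 1` for a weight `ρ > 0` (`‖Ṽ‖_h = normV … κ ρ N(·)` of the
profile `N(1) = N₁`, `N(2) = |U||β|/N`), then for EVERY total momentum `Qm` and all `k, k′`: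
`‖klPairAmplitude … 0 Qm k k′ − U‖ ≤ (96·N/β) · (ρ⁻⁴ · e‖Ṽ‖_h · θ/(1 − θ))`. -/
theorem norm_klPairAmplitude_zero_sub_le_of_gridStep [NeZero M] {β : ℝ} (hβ : 0 < β) (U μ : ℝ) (K : TrigPolyC4v)
    {κ : ℝ} (hκ : 0 < κ)
    (hGB : IsGramBoundedR ((hubbardGridSub L M β (2 * (2 * M))).transpose * hubbardCovAboveCT L M β μ 0 K klE0 *
      hubbardGridSub L M β (2 * (2 * M))) κ)
    {α : ℝ} (hα : 0 < α)
    (hrow : ∀ X, ∑ Y, ‖((hubbardGridSub L M β (2 * (2 * M))).transpose * hubbardCovAboveCT L M β μ 0 K klE0 *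
      hubbardGridSub L M β (2 * (2 * M))) X Y‖ ≤ α)
    (hcol : ∀ Y, ∑ X, ‖((hubbardGridSub L M β (2 * (2 * M))).transpose * hubbardCovAboveCT L M β μ 0 K klE0 *
      hubbardGridSub L M β (2 * (2 * M))) X Y‖ ≤ α)
    {ρ : ℝ} (hρ : 0 < ρ) {N₁ : ℝ} (hN₁ : 0 ≤ N₁)
    (hct : ∀ (j : Fin 2) (w : GridLeg (GridPoint L (2 * (2 * M)))),
      ∑ Y ∈ univ.filter (fun Y : Fin 2 → GridLeg (GridPoint L (2 * (2 * M))) => Y j = w),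
        ‖kernel ℂ (hubbardGridCounterQuadratic L (2 * (2 * M)) β K) 2 Y‖ ≤ N₁)
    (hθ : Real.exp 1 * α * normV (GridLeg (GridPoint L (2 * (2 * M)))) κ ρ
      (fun m' : ℕ => if m' = 1 then N₁ else if m' = 2 then |U| * |β| / (2 * (2 * M) : ℕ) else 0) / κ ^ 2 < 1)
    (Qm k k' : TorusSite 2 L) :
    ‖klPairAmplitude L M β U μ K 0 Qm k k' - (U : ℂ)‖ ≤
      96 * ((2 * (2 * M) : ℕ) : ℝ) / β *
        (ρ⁻¹ ^ 4 * (Real.exp 1 * normV (GridLeg (GridPoint L (2 * (2 * M)))) κ ρ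
            (fun m' : ℕ => if m' = 1 then N₁ else if m' = 2 then |U| * |β| / (2 * (2 * M) : ℕ) else 0)) *
          (Real.exp 1 * α * normV (GridLeg (GridPoint L (2 * (2 * M)))) κ ρ
            (fun m' : ℕ => if m' = 1 then N₁ else if m' = 2 then |U| * |β| / (2 * (2 * M) : ℕ) else 0) / κ ^ 2) /
          (1 - Real.exp 1 * α * normV (GridLeg (GridPoint L (2 * (2 * M)))) κ ρ
            (fun m' : ℕ => if m' = 1 then N₁ else if m' = 2 then |U| * |β| / (2 * (2 * M) : ℕ) else 0) / κ ^ 2)) := by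
  -- notation
  set Ng : ℕ := 2 * (2 * M) with hNg
  haveI : NeZero Ng := ⟨by rw [hNg]; have := NeZero.ne M; omega⟩
  set S := hubbardGridSub L M β Ng with hS
  set C' := S.transpose * hubbardCovAboveCT L M β μ 0 K klE0 * S with hC'
  set Vt := hubbardGridInteraction L Ng β U + hubbardGridCounterQuadratic L Ng β K with hVt
  set prof : ℕ → ℝ := fun m' : ℕ => if m' = 1 then N₁ else if m' = 2 then |U| * |β| / Ng else 0 with hprof
  set B : ℝ := ρ⁻¹ ^ 4 * (Real.exp 1 * normV (GridLeg (GridPoint L Ng)) κ ρ prof) *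
      (Real.exp 1 * α * normV (GridLeg (GridPoint L Ng)) κ ρ prof / κ ^ 2) /
      (1 - Real.exp 1 * α * normV (GridLeg (GridPoint L Ng)) κ ρ prof / κ ^ 2) with hB
  have hL : (0 : ℝ) < L := by exact_mod_cast Nat.pos_of_ne_zero (NeZero.ne L)
  -- (1) the pair amplitude and the bare value as vertex functions of grid images
  have hval : klPairAmplitude L M β U μ K 0 Qm k k' =
      vertexFn L M β (ExteriorAlgebra.map (Matrix.toLin' S) (effAction ℂ C' Vt)) 4 (pairLegs L M Qm k k') := by
    rw [klPairAmplitude, klEffectiveAction_zero_eq_map_hubbardGridSub hβ.ne' U μ K klE0]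
    rfl
  have hbare : (U : ℂ) = vertexFn L M β (ExteriorAlgebra.map (Matrix.toLin' S) Vt) 4 (pairLegs L M Qm k k') := by
    rw [hVt, hS, map_hubbardGridSub_gridInteractionCT hβ.ne' U K (by rw [hNg]; omega) (by rw [hNg]; omega),
      vertexFn_hubbardInteractionCT_pairLegs hβ.ne']
  have hdiff : klPairAmplitude L M β U μ K 0 Qm k k' - (U : ℂ) =
      vertexFn L M β (ExteriorAlgebra.map (Matrix.toLin' S) (effAction ℂ C' Vt - Vt)) 4 (pairLegs L M Qm k k') := by
    rw [hval, hbare, map_sub, klsv_vertexFn_sub]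
  -- (2) the quartic kernel of `effAction C' Vt - Vt` is second order (pinned)
  have hVt_even : Vt ∈ evenPart ℂ (GridLeg (GridPoint L Ng)) :=
    add_mem (hubbardGridInteraction_mem_evenPart β U) (hubbardGridCounterQuadratic_mem_evenPart β K)
  have hVt0 : constPart ℂ Vt = 0 := by
    rw [hVt, map_add, constPart_hubbardGridInteraction, constPart_hubbardGridCounterQuadratic, add_zero]
  have hpin : ∀ w : GridLeg (GridPoint L Ng),
      ∑ W ∈ univ.filter (fun W : Fin 4 → GridLeg (GridPoint L Ng) => W ⟨0, by norm_num⟩ = w),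
        ‖kernel ℂ (effAction ℂ C' Vt - Vt) 4 W‖ ≤ B := fun w =>
    sum_norm_kernel_four_effAction_sub_le_of_gramBounded C' hκ hGB Vt hVt_even hVt0 prof (klsv_profile_nonneg β U Ng hN₁)
      (klsv_sum_norm_kernel_gridVertex_le β U K hN₁ hct) hα hrow hcol hρ hθ (fun m' hm' => klsv_profile_of_two_lt β U Ng N₁ hm') _ w
  -- (3) values from pinned grid norms
  have hdom := norm_vertexFn_map_hubbardGridSub_le_of_pinned (M := M) hβ Ng (effAction ℂ C' Vt - Vt) (by norm_num : 1 ≤ 4)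
    (pairLegs L M Qm k k') hpin
  rw [hdiff]
  refine hdom.trans (le_of_eq ?_)
  rw [card_gridLeg_gridPoint, show ((4 : ℕ).factorial : ℝ) = 24 by norm_num [Nat.factorial]]
  push_cast
  field_simp
  ring

/-- **The pair-amplitude ultraviolet clause for every admissible frame, modulo the step data** — the same at the tree's `M`-, `β`-uniform
scale-`0` Gram constant `κ₀ = √(2(7+6047))` (`isGramBoundedR_scaleZero_of_frameOK_sharp`: `FrameOK R U N μ K`, `klBetaMin ≤ β ≤ L`) and
weight `ρ = κ₀`: `‖klPairAmplitude … 0 Qm k k′ − U‖ ≤ (96·N/β)·(κ₀⁻⁴·e‖Ṽ‖_h·θ/(1−θ))`, `θ = eα‖Ṽ‖_h/κ₀²`. -/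
theorem norm_klPairAmplitude_zero_sub_le_of_frameOK [NeZero M] {R : RenConsts} {U : ℝ} {N : ℕ} {μ : ℝ} {K : TrigPolyC4v}
    (hK : FrameOK R U N μ K) {β : ℝ} (hβ : klBetaMin ≤ β) (hβL : β ≤ L)
    {α : ℝ} (hα : 0 < α)
    (hrow : ∀ X, ∑ Y, ‖((hubbardGridSub L M β (2 * (2 * M))).transpose * hubbardCovAboveCT L M β μ 0 K klE0 *
      hubbardGridSub L M β (2 * (2 * M))) X Y‖ ≤ α)
    (hcol : ∀ Y, ∑ X, ‖((hubbardGridSub L M β (2 * (2 * M))).transpose * hubbardCovAboveCT L M β μ 0 K klE0 *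
      hubbardGridSub L M β (2 * (2 * M))) X Y‖ ≤ α)
    {N₁ : ℝ} (hN₁ : 0 ≤ N₁)
    (hct : ∀ (j : Fin 2) (w : GridLeg (GridPoint L (2 * (2 * M)))),
      ∑ Y ∈ univ.filter (fun Y : Fin 2 → GridLeg (GridPoint L (2 * (2 * M))) => Y j = w),
        ‖kernel ℂ (hubbardGridCounterQuadratic L (2 * (2 * M)) β K) 2 Y‖ ≤ N₁)
    (hθ : Real.exp 1 * α * normV (GridLeg (GridPoint L (2 * (2 * M)))) (Real.sqrt (2 * (7 + 6047))) (Real.sqrt (2 * (7 + 6047)))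
      (fun m' : ℕ => if m' = 1 then N₁ else if m' = 2 then |U| * |β| / (2 * (2 * M) : ℕ) else 0) / Real.sqrt (2 * (7 + 6047)) ^ 2 < 1)
    (Qm k k' : TorusSite 2 L) :
    ‖klPairAmplitude L M β U μ K 0 Qm k k' - (U : ℂ)‖ ≤
      96 * ((2 * (2 * M) : ℕ) : ℝ) / β *
        ((Real.sqrt (2 * (7 + 6047)))⁻¹ ^ 4 *
          (Real.exp 1 * normV (GridLeg (GridPoint L (2 * (2 * M)))) (Real.sqrt (2 * (7 + 6047))) (Real.sqrt (2 * (7 + 6047)))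
            (fun m' : ℕ => if m' = 1 then N₁ else if m' = 2 then |U| * |β| / (2 * (2 * M) : ℕ) else 0)) *
          (Real.exp 1 * α * normV (GridLeg (GridPoint L (2 * (2 * M)))) (Real.sqrt (2 * (7 + 6047))) (Real.sqrt (2 * (7 + 6047)))
            (fun m' : ℕ => if m' = 1 then N₁ else if m' = 2 then |U| * |β| / (2 * (2 * M) : ℕ) else 0) / Real.sqrt (2 * (7 + 6047)) ^ 2) /
          (1 - Real.exp 1 * α * normV (GridLeg (GridPoint L (2 * (2 * M)))) (Real.sqrt (2 * (7 + 6047))) (Real.sqrt (2 * (7 + 6047)))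
            (fun m' : ℕ => if m' = 1 then N₁ else if m' = 2 then |U| * |β| / (2 * (2 * M) : ℕ) else 0) / Real.sqrt (2 * (7 + 6047)) ^ 2)) := by
  have hβpos : 0 < β := lt_of_lt_of_le (by norm_num [klBetaMin]) hβ
  have hκ : 0 < Real.sqrt (2 * (7 + 6047)) := Real.sqrt_pos.2 (by norm_num)
  exact norm_klPairAmplitude_zero_sub_le_of_gridStep hβpos U μ K hκ (isGramBoundedR_scaleZero_of_frameOK_sharp hK hβ hβL) hα hrow
    hcol hκ hN₁ hct hθ Qm k k'

/-! ## §4 The registered clause shapes, given the numeric comparison -/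

/-- **The pair-amplitude ultraviolet clause of `stub_engine_scale0`** from the step data and the comparison of the second-order bound with the
package tolerance `initDevBar G U + legDressBarQ G P Q U 0 4` (ball membership is not used). -/
theorem pairAmplitudeUV_zero_of_gridStep [NeZero M] {β : ℝ} (hβ : 0 < β) (U μ : ℝ) (K : TrigPolyC4v)
    {κ : ℝ} (hκ : 0 < κ)
    (hGB : IsGramBoundedR ((hubbardGridSub L M β (2 * (2 * M))).transpose * hubbardCovAboveCT L M β μ 0 K klE0 *
      hubbardGridSub L M β (2 * (2 * M))) κ)
    {α : ℝ} (hα : 0 < α)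
    (hrow : ∀ X, ∑ Y, ‖((hubbardGridSub L M β (2 * (2 * M))).transpose * hubbardCovAboveCT L M β μ 0 K klE0 *
      hubbardGridSub L M β (2 * (2 * M))) X Y‖ ≤ α)
    (hcol : ∀ Y, ∑ X, ‖((hubbardGridSub L M β (2 * (2 * M))).transpose * hubbardCovAboveCT L M β μ 0 K klE0 *
      hubbardGridSub L M β (2 * (2 * M))) X Y‖ ≤ α)
    {ρ : ℝ} (hρ : 0 < ρ) {N₁ : ℝ} (hN₁ : 0 ≤ N₁)
    (hct : ∀ (j : Fin 2) (w : GridLeg (GridPoint L (2 * (2 * M)))),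
      ∑ Y ∈ univ.filter (fun Y : Fin 2 → GridLeg (GridPoint L (2 * (2 * M))) => Y j = w),
        ‖kernel ℂ (hubbardGridCounterQuadratic L (2 * (2 * M)) β K) 2 Y‖ ≤ N₁)
    (hθ : Real.exp 1 * α * normV (GridLeg (GridPoint L (2 * (2 * M)))) κ ρ
      (fun m' : ℕ => if m' = 1 then N₁ else if m' = 2 then |U| * |β| / (2 * (2 * M) : ℕ) else 0) / κ ^ 2 < 1)
    {G : GeoConsts} {P : SplitConsts} {Q : EngConsts}
    (hcmp : 96 * ((2 * (2 * M) : ℕ) : ℝ) / β *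
        (ρ⁻¹ ^ 4 * (Real.exp 1 * normV (GridLeg (GridPoint L (2 * (2 * M)))) κ ρ
            (fun m' : ℕ => if m' = 1 then N₁ else if m' = 2 then |U| * |β| / (2 * (2 * M) : ℕ) else 0)) *
          (Real.exp 1 * α * normV (GridLeg (GridPoint L (2 * (2 * M)))) κ ρ
            (fun m' : ℕ => if m' = 1 then N₁ else if m' = 2 then |U| * |β| / (2 * (2 * M) : ℕ) else 0) / κ ^ 2) /
          (1 - Real.exp 1 * α * normV (GridLeg (GridPoint L (2 * (2 * M)))) κ ρ
            (fun m' : ℕ => if m' = 1 then N₁ else if m' = 2 then |U| * |β| / (2 * (2 * M) : ℕ) else 0) / κ ^ 2)) ≤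
      initDevBar G U + legDressBarQ G P Q U 0 4) :
    ∀ Qm : TorusSite 2 L, ∀ k ∈ klBall L μ K, ∀ k' ∈ klBall L μ K,
      ‖klPairAmplitude L M β U μ K 0 Qm k k' - (U : ℂ)‖ ≤ initDevBar G U + legDressBarQ G P Q U 0 4 :=
  fun Qm k _ k' _ => (norm_klPairAmplitude_zero_sub_le_of_gridStep hβ U μ K hκ hGB hα hrow hcol hρ hN₁ hct hθ Qm k k').trans hcmp

/-- **(E2-v8) at scale `0`** (`PairLadderStepAtV8 … 0`: its `1 ≤ 0` conjunct is vacuous) from the step data and the comparison. -/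
theorem pairLadderStepAtV8_zero_of_gridStep [NeZero M] {β : ℝ} (hβ : 0 < β) (U μ : ℝ) (K : TrigPolyC4v)
    {κ : ℝ} (hκ : 0 < κ)
    (hGB : IsGramBoundedR ((hubbardGridSub L M β (2 * (2 * M))).transpose * hubbardCovAboveCT L M β μ 0 K klE0 *
      hubbardGridSub L M β (2 * (2 * M))) κ)
    {α : ℝ} (hα : 0 < α)
    (hrow : ∀ X, ∑ Y, ‖((hubbardGridSub L M β (2 * (2 * M))).transpose * hubbardCovAboveCT L M β μ 0 K klE0 *
      hubbardGridSub L M β (2 * (2 * M))) X Y‖ ≤ α)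
    (hcol : ∀ Y, ∑ X, ‖((hubbardGridSub L M β (2 * (2 * M))).transpose * hubbardCovAboveCT L M β μ 0 K klE0 *
      hubbardGridSub L M β (2 * (2 * M))) X Y‖ ≤ α)
    {ρ : ℝ} (hρ : 0 < ρ) {N₁ : ℝ} (hN₁ : 0 ≤ N₁)
    (hct : ∀ (j : Fin 2) (w : GridLeg (GridPoint L (2 * (2 * M)))),
      ∑ Y ∈ univ.filter (fun Y : Fin 2 → GridLeg (GridPoint L (2 * (2 * M))) => Y j = w),
        ‖kernel ℂ (hubbardGridCounterQuadratic L (2 * (2 * M)) β K) 2 Y‖ ≤ N₁)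
    (hθ : Real.exp 1 * α * normV (GridLeg (GridPoint L (2 * (2 * M)))) κ ρ
      (fun m' : ℕ => if m' = 1 then N₁ else if m' = 2 then |U| * |β| / (2 * (2 * M) : ℕ) else 0) / κ ^ 2 < 1)
    {G : GeoConsts} {P : SplitConsts} {Q : EngConsts}
    (hcmp : 96 * ((2 * (2 * M) : ℕ) : ℝ) / β *
        (ρ⁻¹ ^ 4 * (Real.exp 1 * normV (GridLeg (GridPoint L (2 * (2 * M)))) κ ρ
            (fun m' : ℕ => if m' = 1 then N₁ else if m' = 2 then |U| * |β| / (2 * (2 * M) : ℕ) else 0)) *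
          (Real.exp 1 * α * normV (GridLeg (GridPoint L (2 * (2 * M)))) κ ρ
            (fun m' : ℕ => if m' = 1 then N₁ else if m' = 2 then |U| * |β| / (2 * (2 * M) : ℕ) else 0) / κ ^ 2) /
          (1 - Real.exp 1 * α * normV (GridLeg (GridPoint L (2 * (2 * M)))) κ ρ
            (fun m' : ℕ => if m' = 1 then N₁ else if m' = 2 then |U| * |β| / (2 * (2 * M) : ℕ) else 0) / κ ^ 2)) ≤
      initDevBar G U + legDressBarQ G P Q U 0 4) :
    PairLadderStepAtV8 L M G P Q β U μ K 0 ∧ QuarticValueUVAtS2 L M G P Q β U μ K 0 := by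
  have hUV := pairAmplitudeUV_zero_of_gridStep hβ U μ K hκ hGB hα hrow hcol hρ hN₁ hct hθ hcmp
  have hE2 : PairLadderStepAtV8 L M G P Q β U μ K 0 := ⟨fun _ => hUV, fun h1 => absurd h1 (by omega)⟩
  exact ⟨hE2, klvr_quarticValueUVAtS2_of_pairLadderStepAtV8 hE2⟩

end Summit.HubbardSuperconductivity.HubbardSuperconductivity.Theorems.EngineV8

end
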